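import Summits.QuantumAdvantage.QuantumAdvantage.Theorems.OneQuadAsymptoticA
import Literature.Combinatorics.Additive.BogolyubovRuzsaFiniteField

set_option linter.dupNamespace false

/-!
# OneQuadFromFactA (lens 4, g29; (c0) = `OneQuadNoPerfectOdd` from the NAMED Literature fact)

Blocker `X = AbsorptionDial.NoPerfectPolyOdd` (item 28487); decomp-qadv lens 4, g29.

The one-line link that THE MODEL asks for: the (c0) sub-rung `ColumnBridge.OneQuadNoPerfectOdd` (one quadratic register reading its form through
polylog labels, all other registers polylog-form, `p ≥ 5`: some ring word is lost for all large `n`) follows from the named, cited, unproved-in-Lean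
Literature fact `Literature.Combinatorics.Additive.bogolyubovRuzsaFiniteField` (Sanders 2012, *On the Bogolyubov–Ruzsa lemma*, Anal. PDE 5, Thm 20:
`2A − 2A ⊇ V` with `codim V ≤ C log⁴(1/α)` in `𝔽_pⁿ`), used as a hypothesis `(h : bogolyubovRuzsaFiniteField)` and referenced BY NAME so that the fact is
tracked debt of this line.  Proof: `OneQuadAsymptoticA.oneQuadNoPerfectOdd_of_BR`, whose hypothesis is the fact's body symbol for symbol.
Supports stmt-QuantumAdvantage-28487 (record; `X` itself is NOT claimed).
-/

namespace Summit.QuantumAdvantage.QuantumAdvantage.Theorems.ColumnBridge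

/-- **★ (c0) FROM THE NAMED FACT.**  `bogolyubovRuzsaFiniteField → OneQuadNoPerfectOdd`: the t = 1 rung of the quadratic-grade ladder under
`NoPerfectPolyOdd` is decided in the kernel conditionally on Sanders' finite-field Bogolyubov–Ruzsa lemma (a published theorem, stated as a named
`Prop` in `Literature/Combinatorics/Additive/BogolyubovRuzsaFiniteField.lean`). -/
theorem oneQuadNoPerfectOdd_of_fact (h : Literature.Combinatorics.Additive.bogolyubovRuzsaFiniteField) :
    OneQuadNoPerfectOdd :=
  oneQuadNoPerfectOdd_of_BR h

end Summit.QuantumAdvantage.QuantumAdvantage.Theorems.ColumnBridge
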